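import Summits.KontsevichZagierPeriods.KontsevichZagierPeriods.Theorems.RootDecompRelativeModAbsoluteCylLogSplitP43

/-! # `RootDecompRelativeModAbsoluteCylLogSplitP44` — part 19/27 of the mechanical ≤400-line split of `RungClosure.lean` (sha256 f909f334226f0fb5…)
Source: decomp-kz lens-3 g12 `RungClosure.lean` v9 (HOME/decomp-kz-lens-3/g12/, sha256 f909f334…; critic g4-52/g4-57/g5 CLEARED, «lander: split v9 --supports 30572»): BLOCK I (57 g11 monolith decls missing from P01–P25), BLOCK II/III (WildCertAssembly parts 1–6, 8–10: `Leaf.cellLocalWildCert`, `Leaf.cylKernelZeroLog_of_trees`), Parts 12–13 (`Leaf.regKernelPairDegOne_iff_circlePos_of_trees`), BLOCK G13 (Möbius engine, test §C decided).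
Split by census-1 g9 `gen/splitlean.py`: scopes re-opened with their `open`/`variable`/`set_option` context; mathematics and declaration order unchanged. -/

noncomputable section
open Set MeasureTheory Filter Topology
open scoped BigOperators
open Literature.NumberTheory.Transcendental Literature.ModelTheory.ExponentialFields
namespace Summit.KontsevichZagierPeriods.RootDecompRelativeModAbsolute.Rung30571.RegularisedLogLayer.CylLog.Leaf
/-- Auxiliary step `isSemialgebraic_rat_lt`: is Semialgebraic rat lt. [bookkeeping] -/
private theorem isSemialgebraic_rat_lt (r : ℚ) : IsSemialgebraic ℚ {w : Fin 1 → ℝ | (r : ℝ) < w 0} := by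
  simpa using isSemialgebraic_setOf_eval_lt (k := ℚ) (R := ℝ) (ι := Fin 1) (MvPolynomial.C r) (MvPolynomial.X 0)

/-- Auxiliary step `isSemialgebraic_lt_rat`: is Semialgebraic lt rat. [bookkeeping] -/
private theorem isSemialgebraic_lt_rat (r : ℚ) : IsSemialgebraic ℚ {w : Fin 1 → ℝ | w 0 < (r : ℝ)} := by
  simpa using isSemialgebraic_setOf_eval_lt (k := ℚ) (R := ℝ) (ι := Fin 1) (MvPolynomial.X 0) (MvPolynomial.C r)

/-- Auxiliary step `eq_const_fin1`: eq const fin1. [bookkeeping] -/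
private theorem eq_const_fin1 (x : Fin 1 → ℝ) : x = fun _ => x 0 :=
  funext fun j => congrArg x (Subsingleton.elim j 0)

section T4split
variable {q : ℕ}

/-- **Split lemma.**  A piece `P ⊆ E` cut (a.e.) into an open semialgebraic end-piece `Pe` on which the end package
holds pointwise and an open semialgebraic rest `Pr` on which the non-null coefficients are bounded away from `0`
carries a `LocalWildCert`. -/
theorem localWildCert_of_split {E P Pe Pr : Set (Fin 1 → ℝ)} {c κ : Fin q → (Fin 1 → ℝ) → ℝ} {M : Fin q → ℕ}
    {σ : Fin q → Fin 3} {R : ℕ} {f : Fin R → Fin q → ℤ} {qq : Fin R → (Fin 1 → ℝ) → ℝ}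
    (H : CellHyps q E c κ M σ R f qq)
    (hPE : P ⊆ E) (hPeP : Pe ⊆ P) (hPrP : Pr ⊆ P) (hPeo : IsOpen Pe) (hPesa : IsSemialgebraic ℚ Pe)
    (hPro : IsOpen Pr) (hPrsa : IsSemialgebraic ℚ Pr) (hdisj : Disjoint Pe Pr)
    (hnull : volume (P \ (Pe ∪ Pr)) = 0)
    (hrest : ∃ δ : ℝ, 0 < δ ∧ ∀ i, σ i ≠ 2 → ∀ x ∈ Pr, δ ≤ |κ i x|)
    (hend : EndPackage q R f σ M (fun Q => ∀ x ∈ Pe, Q (fun i => κ i x))) :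
    LocalWildCert P c κ M σ := by
  classical
  have hPeE : Pe ⊆ E := hPeP.trans hPE
  have hPrE : Pr ⊆ E := hPrP.trans hPE
  -- the tame rest
  have htame : TameCell Pr c κ M σ := by
    obtain ⟨δ, hδ, hδP⟩ := hrest
    exact Tame.tameCell_of_away hPrsa (fun i => (H.hc i).mono hPrE hPrsa) (fun i => (H.hκ i).mono hPrE hPrsa)
      (fun i x hx => H.hκ1 i x (hPrE hx)) (fun i hi x hx => H.hσ0 i hi x (hPrE hx))
      (fun i hi x hx => H.hσ1 i hi x (hPrE hx)) (fun i => (H.hL1 i).mono_set hPrE)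
      (fun i hi => Or.inr ⟨δ, hδ, hδP i hi⟩)
  -- the wild end-piece
  have hwild : WildCellCert Pe c κ M σ := by
    obtain ⟨Z, m, δ, Cρ, na, nb, g, h, A, B, β, α, L, ⟨h1, h2, h3, h4, h5, h6, h7⟩, hδ, hCρ, hZσ, hZM, hreg⟩ :=
      hend
    refine wildCellCert_of_pointwise hPesa (fun i => (H.hc i).mono hPeE hPesa) (fun i => (H.hκ i).mono hPeE hPesa)
      (fun i x hx => H.hκ1 i x (hPeE hx)) (fun i hi x hx => H.hσ0 i hi x (hPeE hx))
      (fun i hi x hx => H.hσ1 i hi x (hPeE hx)) (fun i hi x hx => H.hσ2 i hi x (hPeE hx))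
      (fun i => (H.hL1 i).mono_set hPeE) (fun r => (H.hqq r).mono hPeE hPesa)
      (fun r x hx => H.hprod r x (hPeE hx)) (fun i x hx => H.hcoef i x (hPeE hx)) h1 h2 h3 h4 h5 h6 h7 hδ hCρ
      hZσ hZM (fun i hi x hx => (hreg x hx).1 i hi) (fun i hi h2' x hx => (hreg x hx).2.1 i hi h2')
      (fun i k hi hk x hx => (hreg x hx).2.2.1 i k hi hk) (fun s => ?_)
    by_cases hs : L s = true
    · left
      intro x hx
      have h0 := ((hreg x hx).2.2.2 s).1 hs
      simpa only [sgnProd, zW_apply] using h0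
    · right
      intro x hx
      have h0 := ((hreg x hx).2.2.2 s).2 (by simpa using hs)
      simpa only [sgnProd, zW_apply] using h0
  -- two pieces
  refine localWildCert_of_pieces (ι := Bool) (C := fun b => cond b Pe Pr) (fun b => ?_) ?_ ?_ fun b => ?_
  · cases b
    · exact hPrP
    · exact hPeP
  · intro i j hij
    cases i <;> cases j
    · exact absurd rfl hij
    · exact hdisj.symm
    · exact hdisj
    · exact absurd rfl hij
  · rw [← Set.union_eq_iUnion]
    exact hnull
  · cases b
    · exact localWildCert_of_tameCell hPro hPrsa htame
    · exact localWildCert_of_wildCellCert hPeo hPesa hwild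

/-! ### 10e. The four geometries of a one-ended piece -/

/-- Interval piece `(e, r)`, singular end `e` on the left, `r ∈ E` rational. -/
theorem localWildCert_Ioo_left {E : Set (Fin 1 → ℝ)} {c κ : Fin q → (Fin 1 → ℝ) → ℝ} {M : Fin q → ℕ}
    {σ : Fin q → Fin 3} {R : ℕ} {f : Fin R → Fin q → ℤ} {qq : Fin R → (Fin 1 → ℝ) → ℝ}
    (H : CellHyps q E c κ M σ R f qq) {e : ℝ} {r : ℚ} (her : e < r)
    (hPsa : IsSemialgebraic ℚ {w : Fin 1 → ℝ | w 0 ∈ Set.Ioo e (r : ℝ)})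
    (hPE : {w : Fin 1 → ℝ | w 0 ∈ Set.Ioo e (r : ℝ)} ⊆ E) (hrE : (fun _ : Fin 1 => (r : ℝ)) ∈ E) :
    LocalWildCert {w : Fin 1 → ℝ | w 0 ∈ Set.Ioo e (r : ℝ)} c κ M σ := by
  classical
  have hIocE : ∀ t ∈ Set.Ioc e (r : ℝ), (fun _ : Fin 1 => t) ∈ E := by
    intro t ht
    rcases ht.2.lt_or_eq with h | h
    · exact hPE (show (fun _ : Fin 1 => t) ∈ {w : Fin 1 → ℝ | w 0 ∈ Set.Ioo e (r : ℝ)} from ⟨ht.1, h⟩)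
    · rw [h]; exact hrE
  have hcont : ∀ i, ContinuousOn (fun t : ℝ => κ i (fun _ => t)) (Set.Ioc e r) := fun i =>
    (H.hκc i).comp (continuous_pi fun _ => continuous_id).continuousOn fun t ht => hIocE t ht
  have hne : ∀ i, σ i ≠ 2 → ∀ t ∈ Set.Ioc e (r : ℝ), κ i (fun _ => t) ≠ 0 := fun i hi t ht =>
    Tame.ne_zero_of_sigma_ne_two H.hσ0 H.hσ1 i hi _ (hIocE t ht)
  have hφ : ∀ i, IsSemialgebraicFunOn ℚ {w : Fin 1 → ℝ | w 0 ∈ Set.Ioo e (r : ℝ)}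
      (fun x => κ i (fun _ => x 0)) := fun i =>
    ((H.hκ i).mono hPE hPsa).congr fun x _ => congrArg (κ i) (eq_const_fin1 x)
  obtain ⟨Z, m, δ, Cρ, na, nb, g, h, A, B, β, α, L, hLD, hδ, hCρ, hZσ, hZM, hev⟩ :=
    end_analysis_left (fun i t => κ i (fun _ => t)) M σ her hPsa hφ hcont hne f
  obtain ⟨ρ', hρ', hsub⟩ := mem_nhdsGT_iff_exists_Ioo_subset.1 hev
  have hρ'e : e < ρ' := hρ'
  obtain ⟨ρ, heρ, hρlt⟩ := exists_rat_btwn (lt_min hρ'e her)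
  have hρρ' : (ρ : ℝ) < ρ' := hρlt.trans_le (min_le_left _ _)
  have hρr : (ρ : ℝ) < r := hρlt.trans_le (min_le_right _ _)
  -- the two pieces
  have hPeP : {w : Fin 1 → ℝ | w 0 ∈ Set.Ioo e (ρ : ℝ)} ⊆ {w : Fin 1 → ℝ | w 0 ∈ Set.Ioo e (r : ℝ)} :=
    fun w hw => ⟨hw.1, hw.2.trans hρr⟩
  have hPrP : {w : Fin 1 → ℝ | w 0 ∈ Set.Ioo (ρ : ℝ) (r : ℝ)} ⊆ {w : Fin 1 → ℝ | w 0 ∈ Set.Ioo e (r : ℝ)} :=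
    fun w hw => ⟨heρ.trans hw.1, hw.2⟩
  have hPesa : IsSemialgebraic ℚ {w : Fin 1 → ℝ | w 0 ∈ Set.Ioo e (ρ : ℝ)} := by
    have h := hPsa.inter (isSemialgebraic_lt_rat ρ)
    convert h using 1
    ext w
    simp only [Set.mem_setOf_eq, Set.mem_inter_iff, Set.mem_Ioo]
    constructor
    · rintro ⟨h1, h2⟩; exact ⟨⟨h1, h2.trans hρr⟩, h2⟩
    · rintro ⟨⟨h1, -⟩, h2⟩; exact ⟨h1, h2⟩
  have hdisj : Disjoint {w : Fin 1 → ℝ | w 0 ∈ Set.Ioo e (ρ : ℝ)} {w : Fin 1 → ℝ | w 0 ∈ Set.Ioo (ρ : ℝ) (r : ℝ)} :=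
    Set.disjoint_left.2 fun w h1 h2 => lt_irrefl _ (h1.2.trans h2.1)
  have hnull : volume ({w : Fin 1 → ℝ | w 0 ∈ Set.Ioo e (r : ℝ)} \
      ({w : Fin 1 → ℝ | w 0 ∈ Set.Ioo e (ρ : ℝ)} ∪ {w : Fin 1 → ℝ | w 0 ∈ Set.Ioo (ρ : ℝ) (r : ℝ)})) = 0 := by
    refine measure_mono_null (fun w hw => ?_)
      ((Set.finite_singleton (fun _ : Fin 1 => (ρ : ℝ))).measure_zero volume)
    obtain ⟨hwP, hw⟩ := hw
    rw [Set.mem_union, not_or] at hw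
    have h1 : ¬ w 0 < ρ := fun h => hw.1 ⟨hwP.1, h⟩
    have h2 : ¬ (ρ : ℝ) < w 0 := fun h => hw.2 ⟨h, hwP.2⟩
    have h3 : w 0 = ρ := le_antisymm (not_lt.1 h2) (not_lt.1 h1)
    rw [Set.mem_singleton_iff, eq_const_fin1 w, h3]
  have hrest : ∃ δ : ℝ, 0 < δ ∧ ∀ i, σ i ≠ 2 → ∀ x ∈ {w : Fin 1 → ℝ | w 0 ∈ Set.Ioo (ρ : ℝ) (r : ℝ)},
      δ ≤ |κ i x| := by
    have hK : Set.Icc (ρ : ℝ) r ⊆ Set.Ioc e r := fun t ht => ⟨heρ.trans_le ht.1, ht.2⟩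
    obtain ⟨δ', hδ', hP'⟩ := exists_uniform_away (fun i t => κ i (fun _ => t)) σ isCompact_Icc
      (fun i => (hcont i).mono hK) (fun i hi t ht => hne i hi t (hK ht))
    refine ⟨δ', hδ', fun i hi x hx => ?_⟩
    have h := hP' i hi (x 0) ⟨hx.1.le, hx.2.le⟩
    rwa [← eq_const_fin1 x] at h
  refine localWildCert_of_split H hPE hPeP hPrP (isOpen_Ioo.preimage (continuous_apply 0)) hPesa
    (isOpen_Ioo.preimage (continuous_apply 0)) (isSemialgebraic_Ioo_rat ρ r) hdisj hnull hrest
    ⟨Z, m, δ, Cρ, na, nb, g, h, A, B, β, α, L, hLD, hδ, hCρ, hZσ, hZM, fun x hx => ?_⟩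
  have h := hsub ⟨hx.1, hx.2.trans hρρ'⟩
  simp only [Set.mem_setOf_eq] at h
  rwa [← eq_const_fin1 x] at h

end T4split

section T4geom

variable {q : ℕ}

/-- Interval piece `(r, e)`, singular end `e` on the right, `r ∈ E` rational (reflection `t ↦ -t`). -/
theorem localWildCert_Ioo_right {E : Set (Fin 1 → ℝ)} {c κ : Fin q → (Fin 1 → ℝ) → ℝ} {M : Fin q → ℕ}
    {σ : Fin q → Fin 3} {R : ℕ} {f : Fin R → Fin q → ℤ} {qq : Fin R → (Fin 1 → ℝ) → ℝ}
    (H : CellHyps q E c κ M σ R f qq) {e : ℝ} {r : ℚ} (hre : (r : ℝ) < e)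
    (hPsa : IsSemialgebraic ℚ {w : Fin 1 → ℝ | w 0 ∈ Set.Ioo (r : ℝ) e})
    (hPE : {w : Fin 1 → ℝ | w 0 ∈ Set.Ioo (r : ℝ) e} ⊆ E) (hrE : (fun _ : Fin 1 => (r : ℝ)) ∈ E) :
    LocalWildCert {w : Fin 1 → ℝ | w 0 ∈ Set.Ioo (r : ℝ) e} c κ M σ := by
  classical
  have hIcoE : ∀ t ∈ Set.Ico (r : ℝ) e, (fun _ : Fin 1 => t) ∈ E := by
    intro t ht
    rcases ht.1.lt_or_eq with h | h
    · exact hPE (show (fun _ : Fin 1 => t) ∈ {w : Fin 1 → ℝ | w 0 ∈ Set.Ioo (r : ℝ) e} from ⟨h, ht.2⟩)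
    · rw [← h]; exact hrE
  have hcontE : ∀ i, ContinuousOn (fun t : ℝ => κ i (fun _ => t)) (Set.Ico (r : ℝ) e) := fun i =>
    (H.hκc i).comp (continuous_pi fun _ => continuous_id).continuousOn fun t ht => hIcoE t ht
  have hneE : ∀ i, σ i ≠ 2 → ∀ t ∈ Set.Ico (r : ℝ) e, κ i (fun _ => t) ≠ 0 := fun i hi t ht =>
    Tame.ne_zero_of_sigma_ne_two H.hσ0 H.hσ1 i hi _ (hIcoE t ht)
  -- the reflected family on `(-e, -r)`
  have hac : -e < -(r : ℝ) := neg_lt_neg hre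
  have hS : IsSemialgebraic ℚ {x : Fin 1 → ℝ | x 0 ∈ Set.Ioo (-e) (-(r : ℝ))} :=
    isSemialgebraic_reflect_Ioo hPsa
  have hφ : ∀ i, IsSemialgebraicFunOn ℚ {x : Fin 1 → ℝ | x 0 ∈ Set.Ioo (-e) (-(r : ℝ))}
      (fun x => κ i (fun _ => -(x 0))) := fun i =>
    CylLogLeaf.isSemialgebraicFunOn_reflect (φ := fun t => κ i (fun _ => t))
      (((H.hκ i).mono hPE hPsa).congr fun x _ => congrArg (κ i) (eq_const_fin1 x))
  have hcont : ∀ i, ContinuousOn (fun u : ℝ => κ i (fun _ => -u)) (Set.Ioc (-e) (-(r : ℝ))) := fun i =>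
    (hcontE i).comp continuous_neg.continuousOn fun u hu => ⟨by linarith [hu.2], by linarith [hu.1]⟩
  have hne : ∀ i, σ i ≠ 2 → ∀ u ∈ Set.Ioc (-e) (-(r : ℝ)), κ i (fun _ => -u) ≠ 0 := fun i hi u hu =>
    hneE i hi (-u) ⟨by linarith [hu.2], by linarith [hu.1]⟩
  obtain ⟨Z, m, δ, Cρ, na, nb, g, h, A, B, β, α, L, hLD, hδ, hCρ, hZσ, hZM, hev⟩ :=
    end_analysis_left (fun i u => κ i (fun _ => -u)) M σ hac hS hφ hcont hne f
  -- back to `e⁻`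
  have hev' : ∀ᶠ t in 𝓝[<] e, EndRegime σ M Z m δ Cρ g L (fun i => κ i (fun _ => t)) := by
    refine (tendsto_neg_nhdsLT.eventually hev).mono fun t ht => ?_
    simpa only [neg_neg] using ht
  obtain ⟨ρ', hρ', hsub⟩ := mem_nhdsLT_iff_exists_Ioo_subset.1 hev'
  have hρ'e : ρ' < e := hρ'
  obtain ⟨ρ, hltρ, hρe⟩ := exists_rat_btwn (max_lt hρ'e hre)
  have hρ'ρ : ρ' < (ρ : ℝ) := (le_max_left _ _).trans_lt hltρ
  have hrρ : (r : ℝ) < ρ := (le_max_right _ _).trans_lt hltρ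
  -- the two pieces `(ρ, e)` (wild) and `(r, ρ)` (tame)
  have hPeP : {w : Fin 1 → ℝ | w 0 ∈ Set.Ioo (ρ : ℝ) e} ⊆ {w : Fin 1 → ℝ | w 0 ∈ Set.Ioo (r : ℝ) e} :=
    fun w hw => ⟨hrρ.trans hw.1, hw.2⟩
  have hPrP : {w : Fin 1 → ℝ | w 0 ∈ Set.Ioo (r : ℝ) (ρ : ℝ)} ⊆ {w : Fin 1 → ℝ | w 0 ∈ Set.Ioo (r : ℝ) e} :=
    fun w hw => ⟨hw.1, hw.2.trans hρe⟩
  have hPesa : IsSemialgebraic ℚ {w : Fin 1 → ℝ | w 0 ∈ Set.Ioo (ρ : ℝ) e} := by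
    have h := hPsa.inter (isSemialgebraic_rat_lt ρ)
    convert h using 1
    ext w
    simp only [Set.mem_setOf_eq, Set.mem_inter_iff, Set.mem_Ioo]
    constructor
    · rintro ⟨h1, h2⟩; exact ⟨⟨hrρ.trans h1, h2⟩, h1⟩
    · rintro ⟨⟨-, h2⟩, h1⟩; exact ⟨h1, h2⟩
  have hdisj : Disjoint {w : Fin 1 → ℝ | w 0 ∈ Set.Ioo (ρ : ℝ) e}
      {w : Fin 1 → ℝ | w 0 ∈ Set.Ioo (r : ℝ) (ρ : ℝ)} :=
    Set.disjoint_left.2 fun w h1 h2 => lt_irrefl _ (h2.2.trans h1.1)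
  have hnull : volume ({w : Fin 1 → ℝ | w 0 ∈ Set.Ioo (r : ℝ) e} \
      ({w : Fin 1 → ℝ | w 0 ∈ Set.Ioo (ρ : ℝ) e} ∪ {w : Fin 1 → ℝ | w 0 ∈ Set.Ioo (r : ℝ) (ρ : ℝ)})) = 0 := by
    refine measure_mono_null (fun w hw => ?_)
      ((Set.finite_singleton (fun _ : Fin 1 => (ρ : ℝ))).measure_zero volume)
    obtain ⟨hwP, hw⟩ := hw
    rw [Set.mem_union, not_or] at hw
    have h1 : ¬ (ρ : ℝ) < w 0 := fun h => hw.1 ⟨h, hwP.2⟩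
    have h2 : ¬ w 0 < ρ := fun h => hw.2 ⟨hwP.1, h⟩
    have h3 : w 0 = ρ := le_antisymm (not_lt.1 h1) (not_lt.1 h2)
    rw [Set.mem_singleton_iff, eq_const_fin1 w, h3]
  have hrest : ∃ δ : ℝ, 0 < δ ∧ ∀ i, σ i ≠ 2 → ∀ x ∈ {w : Fin 1 → ℝ | w 0 ∈ Set.Ioo (r : ℝ) (ρ : ℝ)},
      δ ≤ |κ i x| := by
    have hK : Set.Icc (r : ℝ) ρ ⊆ Set.Ico (r : ℝ) e := fun t ht => ⟨ht.1, ht.2.trans_lt hρe⟩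
    obtain ⟨δ', hδ', hP'⟩ := exists_uniform_away (fun i t => κ i (fun _ => t)) σ isCompact_Icc
      (fun i => (hcontE i).mono hK) (fun i hi t ht => hneE i hi t (hK ht))
    refine ⟨δ', hδ', fun i hi x hx => ?_⟩
    have h := hP' i hi (x 0) ⟨hx.1.le, hx.2.le⟩
    rwa [← eq_const_fin1 x] at h
  refine localWildCert_of_split H hPE hPeP hPrP (isOpen_Ioo.preimage (continuous_apply 0)) hPesa
    (isOpen_Ioo.preimage (continuous_apply 0)) (isSemialgebraic_Ioo_rat r ρ) hdisj hnull hrest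
    ⟨Z, m, δ, Cρ, na, nb, g, h, A, B, β, α, L, hLD, hδ, hCρ, hZσ, hZM, fun x hx => ?_⟩
  have h := hsub ⟨hρ'ρ.trans hx.1, hx.2⟩
  simp only [Set.mem_setOf_eq] at h
  rwa [← eq_const_fin1 x] at h

/-- Ray piece `(-∞, r)`, `r ∈ E` rational (chart `u ↦ r + 1 - u⁻¹` from `(0, 1]`). -/
theorem localWildCert_Iio {E : Set (Fin 1 → ℝ)} {c κ : Fin q → (Fin 1 → ℝ) → ℝ} {M : Fin q → ℕ}
    {σ : Fin q → Fin 3} {R : ℕ} {f : Fin R → Fin q → ℤ} {qq : Fin R → (Fin 1 → ℝ) → ℝ}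
    (H : CellHyps q E c κ M σ R f qq) {r : ℚ}
    (hPE : {w : Fin 1 → ℝ | w 0 < (r : ℝ)} ⊆ E) (hrE : (fun _ : Fin 1 => (r : ℝ)) ∈ E) :
    LocalWildCert {w : Fin 1 → ℝ | w 0 < (r : ℝ)} c κ M σ := by
  classical
  have hPsa : IsSemialgebraic ℚ {w : Fin 1 → ℝ | w 0 < (r : ℝ)} := isSemialgebraic_lt_rat r
  have hIicE : ∀ t : ℝ, t ≤ (r : ℝ) → (fun _ : Fin 1 => t) ∈ E := by
    intro t ht
    rcases ht.lt_or_eq with h | h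
    · exact hPE (show (fun _ : Fin 1 => t) ∈ {w : Fin 1 → ℝ | w 0 < (r : ℝ)} from h)
    · rw [h]; exact hrE
  have hcontE : ∀ i, ContinuousOn (fun t : ℝ => κ i (fun _ => t)) (Set.Iic (r : ℝ)) := fun i =>
    (H.hκc i).comp (continuous_pi fun _ => continuous_id).continuousOn fun t ht => hIicE t ht
  have hneE : ∀ i, σ i ≠ 2 → ∀ t : ℝ, t ≤ (r : ℝ) → κ i (fun _ => t) ≠ 0 := fun i hi t ht =>
    Tame.ne_zero_of_sigma_ne_two H.hσ0 H.hσ1 i hi _ (hIicE t ht)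
  -- the chart `T u = r + 1 - u⁻¹`, `(0, 1] → (-∞, r]`
  have hT : ∀ u ∈ Set.Ioc (0 : ℝ) 1, (r : ℝ) + 1 - u⁻¹ ≤ r := by
    intro u hu
    have : 1 ≤ u⁻¹ := (one_le_inv₀ hu.1).2 hu.2
    linarith
  have hTc : ContinuousOn (fun u : ℝ => (r : ℝ) + 1 - u⁻¹) (Set.Ioc (0 : ℝ) 1) :=
    continuousOn_const.sub (continuousOn_inv₀.mono fun u hu => ne_of_gt hu.1)
  have hS01 : IsSemialgebraic ℚ {x : Fin 1 → ℝ | x 0 ∈ Set.Ioo (0 : ℝ) 1} := by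
    simpa using isSemialgebraic_Ioo_rat 0 1
  have hφ : ∀ i, IsSemialgebraicFunOn ℚ {x : Fin 1 → ℝ | x 0 ∈ Set.Ioo (0 : ℝ) 1}
      (fun x => κ i (fun _ => (r : ℝ) + 1 - (x 0)⁻¹)) := by
    intro i
    have h1 : IsSemialgebraicFunOn ℚ {w : Fin 1 → ℝ | w 0 < (r : ℝ)} (fun x => κ i (fun _ => x 0)) :=
      ((H.hκ i).mono hPE hPsa).congr fun x _ => congrArg (κ i) (eq_const_fin1 x)
    have h2 := isSemialgebraicFunOn_reflect_ray (φ := fun t => κ i (fun _ => t)) h1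
    have h2' : IsSemialgebraicFunOn ℚ {x : Fin 1 → ℝ | (((-r : ℚ)) : ℝ) < x 0}
        (fun x => κ i (fun _ => -(x 0))) := by
      simpa only [Rat.cast_neg] using h2
    have h3 := CylLogLeaf.isSemialgebraicFunOn_transportInv (φ := fun t => κ i (fun _ => -t)) h2'
    refine h3.congr fun x _ => ?_
    show κ i (fun _ => -((((-r : ℚ)) : ℝ) - 1 + (x 0)⁻¹)) = κ i (fun _ => (r : ℝ) + 1 - (x 0)⁻¹)
    congr 1
    funext
    push_cast
    ring
  have hcont : ∀ i, ContinuousOn (fun u : ℝ => κ i (fun _ => (r : ℝ) + 1 - u⁻¹)) (Set.Ioc (0 : ℝ) 1) :=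
    fun i => (hcontE i).comp hTc fun u hu => hT u hu
  have hne : ∀ i, σ i ≠ 2 → ∀ u ∈ Set.Ioc (0 : ℝ) 1, κ i (fun _ => (r : ℝ) + 1 - u⁻¹) ≠ 0 :=
    fun i hi u hu => hneE i hi _ (hT u hu)
  obtain ⟨Z, m, δ, Cρ, na, nb, g, h, A, B, β, α, L, hLD, hδ, hCρ, hZσ, hZM, hev⟩ :=
    end_analysis_left (fun i u => κ i (fun _ => (r : ℝ) + 1 - u⁻¹)) M σ one_pos hS01 hφ hcont hne f
  -- back to `-∞`
  have hSt : Tendsto (fun t : ℝ => ((r : ℝ) + 1 - t)⁻¹) atBot (𝓝[>] 0) := by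
    refine tendsto_inv_atTop_nhdsGT_zero.comp ?_
    have h := Filter.tendsto_atTop_add_const_left atBot ((r : ℝ) + 1) tendsto_neg_atBot_atTop
    exact h.congr fun t => by ring
  have hev' : ∀ᶠ t in atBot, EndRegime σ M Z m δ Cρ g L (fun i => κ i (fun _ => t)) := by
    refine (hSt.eventually hev).mono fun t ht => ?_
    have e1 : (r : ℝ) + 1 - (((r : ℝ) + 1 - t)⁻¹)⁻¹ = t := by rw [inv_inv]; ring
    simpa only [e1] using ht
  obtain ⟨T₀, hT₀⟩ := eventually_atBot.1 hev'
  obtain ⟨ρ, hρ⟩ := exists_rat_lt (min T₀ (r : ℝ))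
  have hρT : (ρ : ℝ) < T₀ := hρ.trans_le (min_le_left _ _)
  have hρr : (ρ : ℝ) < r := hρ.trans_le (min_le_right _ _)
  -- the two pieces `(-∞, ρ)` (wild) and `(ρ, r)` (tame)
  have hPeP : {w : Fin 1 → ℝ | w 0 < (ρ : ℝ)} ⊆ {w : Fin 1 → ℝ | w 0 < (r : ℝ)} :=
    fun w hw => lt_trans hw hρr
  have hPrP : {w : Fin 1 → ℝ | w 0 ∈ Set.Ioo (ρ : ℝ) (r : ℝ)} ⊆ {w : Fin 1 → ℝ | w 0 < (r : ℝ)} :=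
    fun w hw => hw.2
  have hdisj : Disjoint {w : Fin 1 → ℝ | w 0 < (ρ : ℝ)} {w : Fin 1 → ℝ | w 0 ∈ Set.Ioo (ρ : ℝ) (r : ℝ)} :=
    Set.disjoint_left.2 fun w h1 h2 => lt_irrefl _ (lt_trans h1 h2.1)
  have hnull : volume ({w : Fin 1 → ℝ | w 0 < (r : ℝ)} \
      ({w : Fin 1 → ℝ | w 0 < (ρ : ℝ)} ∪ {w : Fin 1 → ℝ | w 0 ∈ Set.Ioo (ρ : ℝ) (r : ℝ)})) = 0 := by
    refine measure_mono_null (fun w hw => ?_)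
      ((Set.finite_singleton (fun _ : Fin 1 => (ρ : ℝ))).measure_zero volume)
    obtain ⟨hwP, hw⟩ := hw
    rw [Set.mem_union, not_or] at hw
    have h1 : ¬ w 0 < ρ := fun h => hw.1 h
    have h2 : ¬ (ρ : ℝ) < w 0 := fun h => hw.2 ⟨h, hwP⟩
    have h3 : w 0 = ρ := le_antisymm (not_lt.1 h2) (not_lt.1 h1)
    rw [Set.mem_singleton_iff, eq_const_fin1 w, h3]
  have hrest : ∃ δ : ℝ, 0 < δ ∧ ∀ i, σ i ≠ 2 → ∀ x ∈ {w : Fin 1 → ℝ | w 0 ∈ Set.Ioo (ρ : ℝ) (r : ℝ)},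
      δ ≤ |κ i x| := by
    have hK : Set.Icc (ρ : ℝ) r ⊆ Set.Iic (r : ℝ) := fun t ht => ht.2
    obtain ⟨δ', hδ', hP'⟩ := exists_uniform_away (fun i t => κ i (fun _ => t)) σ isCompact_Icc
      (fun i => (hcontE i).mono hK) (fun i hi t ht => hneE i hi t (hK ht))
    refine ⟨δ', hδ', fun i hi x hx => ?_⟩
    have h := hP' i hi (x 0) ⟨hx.1.le, hx.2.le⟩
    rwa [← eq_const_fin1 x] at h
  refine localWildCert_of_split H hPE hPeP hPrP (isOpen_lt (continuous_apply 0) continuous_const)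
    (isSemialgebraic_lt_rat ρ) (isOpen_Ioo.preimage (continuous_apply 0)) (isSemialgebraic_Ioo_rat ρ r)
    hdisj hnull hrest ⟨Z, m, δ, Cρ, na, nb, g, h, A, B, β, α, L, hLD, hδ, hCρ, hZσ, hZM, fun x hx => ?_⟩
  have hx' : x 0 < (ρ : ℝ) := hx
  have h := hT₀ (x 0) (lt_trans hx' hρT).le
  rwa [← eq_const_fin1 x] at h

end T4geom
end Summit.KontsevichZagierPeriods.RootDecompRelativeModAbsolute.Rung30571.RegularisedLogLayer.CylLog.Leaf
end
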